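import Literature.Computability.AlgebraicComplexity.MW21SingularTuplesNullCone
import Literature.NumberTheory.DiophantineGeometry.DetStabilizerFrobeniusProofs
import HarnessLib

/-!
# Symmetries of the determinant hypersurface (Makam–Wigderson 2021, Thm. 1.12): discharge of
# `makamWigderson2021_thm_1_12`

Sibling proof file of `Literature/Computability/AlgebraicComplexity/MW21SingularTuplesNullCone.lean`
(cell `val-lit`, cross-ladder typing row X3-MW21), discharging its named fact
`Literature.Computability.AlgebraicComplexity.makamWigderson2021_thm_1_12` (V. Makam, A. Wigderson,
*Singular tuples of matrices is not a null cone (and the symmetries of algebraic varieties)*,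
J. reine angew. Math. **780** (2021) = arXiv:1909.00857, Thm. 1.12 "(Frobenius)", p0006:L30, in
the reading the paper itself uses in §6 and in Thm. 1.13 at `m = 1`): for `n ≥ 1` the group of
symmetries of `SING_{n,1} = {X ∈ Mat_n : det X = 0}` is `G_{n,1} ∪ G_{n,1}·τ`, i.e. every
invertible linear map `g` of `Mat_n` with `g(SING) = SING` is `X ↦ PXQ` or `X ↦ PXᵀQ` with
`P, Q ∈ GL_n`. Honest framing: a discharge of a typed classical statement (Frobenius 1897,
Dieudonné 1949); nothing here bears on VP versus VNP.

## Proof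

The inclusion `G_{n,1} ∪ G_{n,1}·τ ⊆ 𝒢_{SING}` is the tree's `mem_symmetryGroup_SING_of_mem_G_or`.
Conversely (Dieudonné's argument): a linear bijection `T` of `Mat_n` with `T(SING) = SING` maps
matrices of rank `≤ 1` to matrices of rank `≤ 1`, because rank `≤ 1` is detected by the singular
cone alone — `X` has rank `≤ 1` iff for every `Y` the set `{t : det(Y + tX) = 0}` is all of `ℂ` or
has at most one element (`det(Y + t u wᵀ)` is affine in `t`; if `X = P·diag(d)·Q` by elementary
operations with two nonzero `dᵢ`, the matrix `Y = P·diag(y)·Q` with `y = -d` resp. `-2d` at those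
places and `1` elsewhere gives the roots `1, 2` and not `0`) — and this criterion is transported by
`T`. The tree's Marcus–Moyls engine `MarcusMoyls.exists_sandwich_or_transpose_sandwich`
(`DetStabilizerFrobeniusProofs.lean`: a linear bijection preserving rank `≤ 1` in both directions is
`X ↦ UXV` or `X ↦ UXᵀV`) then gives the sandwich form; `U, V` are invertible because `T` is onto,
and the sandwich is the action of `(1, U, (V⁻¹)) ∈ GL_1 × GL_n × GL_n`. The case `n = 1` (all maps
are scalars) is treated apart. Everything is proved; no definitions are introduced.

## References

* [MakamWigderson2021] V. Makam, A. Wigderson, J. reine angew. Math. 780 (2021) =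
  arXiv:1909.00857, Thm. 1.12 (p0006:L30), §6 (p0015:L5).
* G. Frobenius, *Über die Darstellung der endlichen Gruppen durch lineare Substitutionen*,
  Sitzungsber. Preuss. Akad. (1897), §7; J. Dieudonné, *Sur une généralisation du groupe
  orthogonal à quatre variables*, Arch. Math. 1 (1949) 282–287; M. Marcus, B. N. Moyls, *Linear
  transformations on algebras of matrices*, Canad. J. Math. 11 (1959) (the tree's engine).
-/

noncomputable section

open Matrix

namespace Literature.Computability.AlgebraicComplexity

namespace MakamWigderson

open Literature.NumberTheory.DiophantineGeometry

variable {n : ℕ}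

/-! ### Rank `≤ 1` is detected by the singular cone -/

/-- `det(Y + t·u wᵀ)` is affine in `t`: its root set is everything or a subsingleton.
[cite: MakamWigderson2021, Thm. 1.12 (proof)] -/
theorem rootSet_vecMulVec (Y : Matrix (Fin n) (Fin n) ℂ) (u w : Fin n → ℂ) :
    (∀ t : ℂ, (Y + t • vecMulVec u w).det = 0) ∨
      Set.Subsingleton {t : ℂ | (Y + t • vecMulVec u w).det = 0} := by
  set b : ℂ := ∑ i, u i * (Y.updateRow i w).det with hb
  have hdet : ∀ t : ℂ, (Y + t • vecMulVec u w).det = Y.det + t * b := by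
    intro t
    rw [← smul_vecMulVec, MarcusMoyls.det_add_vecMulVec, hb, Finset.mul_sum]
    refine congrArg _ (Finset.sum_congr rfl fun i _ => ?_)
    rw [Pi.smul_apply, smul_eq_mul, mul_assoc]
  by_cases hb0 : b = 0
  · by_cases hY : Y.det = 0
    · left
      intro t
      rw [hdet, hY, hb0, mul_zero, add_zero]
    · right
      intro t ht
      exfalso
      rw [Set.mem_setOf_eq, hdet, hb0, mul_zero, add_zero] at ht
      exact hY ht
  · right
    intro t ht s hs
    rw [Set.mem_setOf_eq, hdet] at ht hs
    have h : (t - s) * b = 0 := by linear_combination ht - hs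
    rcases mul_eq_zero.mp h with h | h
    · exact sub_eq_zero.mp h
    · exact absurd h hb0

/-- **Witness for rank `≥ 2`**: if `X` is not of the form `u wᵀ` then for some `Y` the root set
of `t ↦ det(Y + tX)` contains `1` and `2` but not `0` (`X = P diag(d) Q` by elementary operations,
two `dᵢ ≠ 0`; `Y = P diag(y) Q`). [cite: MakamWigderson2021, Thm. 1.12 (proof)] -/
theorem exists_rootSet_bad {X : Matrix (Fin n) (Fin n) ℂ} (hX : ∀ u w : Fin n → ℂ, X ≠ vecMulVec u w) :
    ∃ Y : Matrix (Fin n) (Fin n) ℂ, (Y + (1 : ℂ) • X).det = 0 ∧ (Y + (2 : ℂ) • X).det = 0 ∧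
      (Y + (0 : ℂ) • X).det ≠ 0 := by
  obtain ⟨L, L', d, hd⟩ := Pivot.exists_list_transvec_mul_diagonal_mul_list_transvec X
  set P := (L.map TransvectionStruct.toMatrix).prod with hP
  set Q := (L'.map TransvectionStruct.toMatrix).prod with hQ
  have hPdet : P.det = 1 := TransvectionStruct.det_toMatrix_prod L
  have hQdet : Q.det = 1 := TransvectionStruct.det_toMatrix_prod L'
  have hdet : ∀ v : Fin n → ℂ, (P * diagonal v * Q).det = ∏ i, v i := by
    intro v
    rw [det_mul, det_mul, hPdet, hQdet, det_diagonal, one_mul, mul_one]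
  -- two non-zero diagonal entries (as in the tree's `MarcusMoyls.exists_det_add_add_det_sub_ne`)
  obtain ⟨a, c, hac, ha, hc⟩ : ∃ a c, a ≠ c ∧ d a ≠ 0 ∧ d c ≠ 0 := by
    by_contra! H
    have hdiag0 : diagonal (0 : Fin n → ℂ) = 0 := by
      ext i j
      simp [diagonal_apply]
    by_cases hd0 : d = 0
    · refine hX 0 0 ?_
      rw [hd, hd0, hdiag0, Matrix.mul_zero, Matrix.zero_mul, vecMulVec_zero]
    obtain ⟨a, ha⟩ : ∃ a, d a ≠ 0 := by
      by_contra! h0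
      exact hd0 (funext h0)
    have hda : d = Pi.single a (d a) := by
      funext c
      by_cases hca : c = a
      · subst hca
        simp
      · rw [Pi.single_eq_of_ne hca]
        exact H a c (Ne.symm hca) ha
    have hdiag : diagonal d = vecMulVec (d a • Pi.single a 1) (Pi.single a (1 : ℂ)) := by
      conv_lhs => rw [hda]
      rw [diagonal_single, smul_vecMulVec, ← single_eq_single_vecMulVec_single, smul_single,
        smul_eq_mul, mul_one]
    refine hX (P *ᵥ (d a • Pi.single a 1)) (Pi.single a 1 ᵥ* Q) ?_
    rw [hd, hdiag, Matrix.mul_assoc, vecMulVec_mul, mul_vecMulVec]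
  -- the witness `y`: `y a = -d a`, `y c = -2 d c`, `y i = 1` otherwise
  classical
  let y : Fin n → ℂ := fun i => if i = a then -d a else if i = c then -2 * d c else 1
  have hya : y a + 1 * d a = 0 := by simp [y]
  have hyc : y c + 2 * d c = 0 := by
    simp only [y, Ne.symm hac, if_false, if_true]
    ring
  have hy0 : ∀ i, y i + 0 * d i ≠ 0 := by
    intro i
    rw [zero_mul, add_zero]
    dsimp only [y]
    split_ifs
    · exact neg_ne_zero.mpr ha
    · exact mul_ne_zero (by norm_num) hc
    · exact one_ne_zero
  have hsum : ∀ t : ℂ, P * diagonal y * Q + t • X = P * diagonal (fun i => y i + t * d i) * Q := by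
    intro t
    have ht : t • X = P * diagonal (t • d) * Q := by
      rw [hd, diagonal_smul, Matrix.mul_smul, Matrix.smul_mul]
    rw [ht, ← Matrix.add_mul, ← Matrix.mul_add, diagonal_add]
    rfl
  refine ⟨P * diagonal y * Q, ?_, ?_, ?_⟩
  · rw [hsum, hdet]
    exact Finset.prod_eq_zero (Finset.mem_univ a) hya
  · rw [hsum, hdet]
    exact Finset.prod_eq_zero (Finset.mem_univ c) hyc
  · rw [hsum, hdet]
    exact Finset.prod_ne_zero_iff.mpr fun i _ => hy0 i

/-- **Rank `≤ 1` from the singular cone**: if for every `Y` the root set of `t ↦ det(Y + tX)` is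
everything or a subsingleton, then `X = u wᵀ`. [cite: MakamWigderson2021, Thm. 1.12 (proof)] -/
theorem exists_eq_vecMulVec_of_rootSet {X : Matrix (Fin n) (Fin n) ℂ}
    (h : ∀ Y : Matrix (Fin n) (Fin n) ℂ, (∀ t : ℂ, (Y + t • X).det = 0) ∨
      Set.Subsingleton {t : ℂ | (Y + t • X).det = 0}) :
    ∃ u w : Fin n → ℂ, X = vecMulVec u w := by
  by_contra hne
  push Not at hne
  obtain ⟨Y, h1, h2, h0⟩ := exists_rootSet_bad hne
  rcases h Y with hall | hsub
  · exact h0 (hall 0)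
  · have h12 : (1 : ℂ) = 2 := hsub h1 h2
    norm_num at h12

/-- The root-set criterion is transported by a linear surjection that detects singularity
(`det(T Z) = 0 ↔ det Z = 0`). [cite: MakamWigderson2021, Thm. 1.12 (proof)] -/
theorem rootSet_map {T S : Matrix (Fin n) (Fin n) ℂ →ₗ[ℂ] Matrix (Fin n) (Fin n) ℂ}
    (hTS : ∀ X, T (S X) = X) (hdet : ∀ Z, (T Z).det = 0 ↔ Z.det = 0)
    {X : Matrix (Fin n) (Fin n) ℂ}
    (hX : ∀ Y : Matrix (Fin n) (Fin n) ℂ, (∀ t : ℂ, (Y + t • X).det = 0) ∨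
      Set.Subsingleton {t : ℂ | (Y + t • X).det = 0}) :
    ∀ Y : Matrix (Fin n) (Fin n) ℂ, (∀ t : ℂ, (Y + t • T X).det = 0) ∨
      Set.Subsingleton {t : ℂ | (Y + t • T X).det = 0} := by
  intro Y'
  have key : ∀ t : ℂ, (Y' + t • T X).det = 0 ↔ (S Y' + t • X).det = 0 := by
    intro t
    rw [← hdet (S Y' + t • X), map_add, map_smul, hTS]
  rcases hX (S Y') with h | h
  · left
    intro t
    exact (key t).mpr (h t)
  · right
    intro t ht s hs
    exact h ((key t).mp ht) ((key s).mp hs)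

/-- **Singularity preservers preserve rank `≤ 1`** (Dieudonné): a linear surjection `T` of `Mat_n`
with `det(T Z) = 0 ↔ det Z = 0` maps every `u wᵀ` to some `u' w'ᵀ`.
[cite: MakamWigderson2021, Thm. 1.12 (proof)] -/
theorem map_vecMulVec_of_det_iff {T S : Matrix (Fin n) (Fin n) ℂ →ₗ[ℂ] Matrix (Fin n) (Fin n) ℂ}
    (hTS : ∀ X, T (S X) = X) (hdet : ∀ Z, (T Z).det = 0 ↔ Z.det = 0) (u w : Fin n → ℂ) :
    ∃ u' w' : Fin n → ℂ, T (vecMulVec u w) = vecMulVec u' w' :=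
  exists_eq_vecMulVec_of_rootSet (rootSet_map hTS hdet fun Y => rootSet_vecMulVec Y u w)

/-! ### `SING_{n,1}` and its symmetries -/

/-- A `1`-tuple is the constant tuple of its only component. [folklore] -/
private theorem const_apply_zero_eq (Z : Tuple n 1) : (fun _ : Fin 1 => Z 0) = Z :=
  funext fun i => by rw [Subsingleton.elim i 0]

/-- `SING_{n,1} = {X : det X₁ = 0}`. [cite: MakamWigderson2021, §1.2 (1)] -/
theorem mem_SING_one_iff (Z : Tuple n 1) : Z ∈ SING n 1 ↔ (Z 0).det = 0 := by
  rw [mem_SING_iff_forall_det_eq_zero]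
  constructor
  · intro h
    have h1 := h fun _ => 1
    rwa [Fin.sum_univ_one, one_smul] at h1
  · intro h c
    rw [Fin.sum_univ_one, Matrix.det_smul, h, mul_zero]

/-- A symmetry maps the set into itself. [cite: MakamWigderson2021, Def. 1.10] -/
private theorem apply_mem_of_mem_symmetryGroup {S : Set (Tuple n 1)}
    {g : LinearMap.GeneralLinearGroup ℂ (Tuple n 1)} (hg : g ∈ symmetryGroup S) {Z : Tuple n 1}
    (hZ : Z ∈ S) : (g : Tuple n 1 →ₗ[ℂ] Tuple n 1) Z ∈ S := by
  have h1 : (fun v => (g : Tuple n 1 →ₗ[ℂ] Tuple n 1) v) Z ∈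
      (fun v => (g : Tuple n 1 →ₗ[ℂ] Tuple n 1) v) '' S := Set.mem_image_of_mem _ hZ
  rwa [(mem_symmetryGroup_iff S g).mp hg] at h1

/-- `g⁻¹ (g Z) = Z` in `GL(Mat_n^m)`. [folklore] -/
private theorem inv_apply_apply (g : LinearMap.GeneralLinearGroup ℂ (Tuple n 1)) (Z : Tuple n 1) :
    ((g⁻¹ : LinearMap.GeneralLinearGroup ℂ (Tuple n 1)) : Tuple n 1 →ₗ[ℂ] Tuple n 1)
      ((g : Tuple n 1 →ₗ[ℂ] Tuple n 1) Z) = Z := by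
  rw [← Module.End.mul_apply, ← Units.val_mul, inv_mul_cancel, Units.val_one, Module.End.one_apply]

/-- `g (g⁻¹ Z) = Z` in `GL(Mat_n^m)`. [folklore] -/
private theorem apply_inv_apply (g : LinearMap.GeneralLinearGroup ℂ (Tuple n 1)) (Z : Tuple n 1) :
    (g : Tuple n 1 →ₗ[ℂ] Tuple n 1)
      (((g⁻¹ : LinearMap.GeneralLinearGroup ℂ (Tuple n 1)) : Tuple n 1 →ₗ[ℂ] Tuple n 1) Z) = Z := by
  rw [← Module.End.mul_apply, ← Units.val_mul, mul_inv_cancel, Units.val_one, Module.End.one_apply]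

/-- A symmetry of `SING_{n,1}` detects singularity: `det (g Z)₁ = 0 ↔ det Z₁ = 0`.
[cite: MakamWigderson2021, Thm. 1.12 (proof)] -/
private theorem det_apply_eq_zero_iff {g : LinearMap.GeneralLinearGroup ℂ (Tuple n 1)}
    (hg : g ∈ symmetryGroup (SING n 1)) (Z : Tuple n 1) :
    ((g : Tuple n 1 →ₗ[ℂ] Tuple n 1) Z 0).det = 0 ↔ (Z 0).det = 0 := by
  rw [← mem_SING_one_iff, ← mem_SING_one_iff]
  constructor
  · intro h
    have h' := apply_mem_of_mem_symmetryGroup ((symmetryGroup (SING n 1)).inv_mem hg) h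
    rwa [inv_apply_apply] at h'
  · exact apply_mem_of_mem_symmetryGroup hg

/-! ### Sandwich form ⇒ membership in `G_{n,1}` -/

/-- A sandwich `X ↦ U X V` with invertible `U, V` is the action of
`(1, U, (V⁻¹)) ∈ GL_1 × GL_n × GL_n`, hence lies in `G_{n,1}`.
[cite: MakamWigderson2021, §1.3 (p0006:L14–18)] -/
private theorem mem_G_one_of_sandwich {g : LinearMap.GeneralLinearGroup ℂ (Tuple n 1)}
    {U V : Matrix (Fin n) (Fin n) ℂ} (hU : U.det ≠ 0) (hV : V.det ≠ 0)
    (h : ∀ Z : Tuple n 1, (g : Tuple n 1 →ₗ[ℂ] Tuple n 1) Z 0 = U * Z 0 * V) : g ∈ G n 1 := by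
  rw [mem_G_iff]
  refine ⟨1, Matrix.GeneralLinearGroup.mkOfDetNeZero U hU,
    (Matrix.GeneralLinearGroup.mkOfDetNeZero V hV)⁻¹, ?_⟩
  apply LinearMap.ext
  intro Z
  funext i
  obtain rfl : i = 0 := Subsingleton.elim i 0
  rw [h Z, tripleAct_apply_eq_sum, Fin.sum_univ_one, Units.val_one, Matrix.one_apply_eq, one_smul,
    inv_inv, Matrix.GeneralLinearGroup.val_mkOfDetNeZero, Matrix.GeneralLinearGroup.val_mkOfDetNeZero,
    Matrix.transpose_transpose]

/-- `n = 1`: every invertible linear map of `Mat_1^1 ≅ ℂ` is a nonzero scalar, hence in `G_{1,1}`.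
[cite: MakamWigderson2021, §1.3 (p0006:L14–18)] -/
private theorem mem_G_of_n_eq_one (g : LinearMap.GeneralLinearGroup ℂ (Tuple 1 1)) : g ∈ G 1 1 := by
  -- the basis vector `E = (1)` and the scalar `c = g(E)₁₁₁`
  let E : Tuple 1 1 := fun _ => 1
  set c : ℂ := (g : Tuple 1 1 →ₗ[ℂ] Tuple 1 1) E 0 0 0 with hc
  have hZ : ∀ Z : Tuple 1 1, Z = Z 0 0 0 • E := by
    intro Z
    funext i
    ext a b
    obtain rfl : i = 0 := Subsingleton.elim i 0
    obtain rfl : a = 0 := Subsingleton.elim a 0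
    obtain rfl : b = 0 := Subsingleton.elim b 0
    simp [E]
  have hgZ : ∀ Z : Tuple 1 1, (g : Tuple 1 1 →ₗ[ℂ] Tuple 1 1) Z = (Z 0 0 0 * c) • E := by
    intro Z
    rw [hZ Z, map_smul, ← hZ Z, mul_smul]
    congr 1
    rw [hZ ((g : Tuple 1 1 →ₗ[ℂ] Tuple 1 1) E)]
  have hc0 : c ≠ 0 := by
    intro h0
    have hE : (g : Tuple 1 1 →ₗ[ℂ] Tuple 1 1) E = 0 := by
      rw [hgZ E, h0, mul_zero, zero_smul]
    have hE' : E = 0 := by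
      have := congrArg (fun W => ((g⁻¹ : LinearMap.GeneralLinearGroup ℂ (Tuple 1 1)) :
        Tuple 1 1 →ₗ[ℂ] Tuple 1 1) W) hE
      simpa only [inv_apply_apply, map_zero] using this
    have : (E 0 0 0 : ℂ) = 0 := by rw [hE']; rfl
    exact one_ne_zero this
  have hU : ((c • (1 : Matrix (Fin 1) (Fin 1) ℂ))).det ≠ 0 := by
    rw [Matrix.det_smul, Matrix.det_one, mul_one, Fintype.card_fin, pow_one]
    exact hc0
  refine mem_G_one_of_sandwich hU (V := 1) (by rw [Matrix.det_one]; exact one_ne_zero) fun Z => ?_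
  rw [hgZ Z, Matrix.mul_one]
  ext a b
  obtain rfl : a = 0 := Subsingleton.elim a 0
  obtain rfl : b = 0 := Subsingleton.elim b 0
  simp [E, Matrix.mul_apply, mul_comm]

/-! ### Thm. 1.12 -/

/-- **The hard inclusion of Thm. 1.12**: every symmetry of `SING_{n,1}` (`n ≥ 1`) lies in
`G_{n,1} ∪ G_{n,1}·τ` (Frobenius / Dieudonné, via rank-one preservation and the tree's Marcus–Moyls
engine). [cite: MakamWigderson2021, Thm. 1.12] -/
theorem mem_G_or_of_mem_symmetryGroup_SING_one (hn : 1 ≤ n)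
    {g : LinearMap.GeneralLinearGroup ℂ (Tuple n 1)} (hg : g ∈ symmetryGroup (SING n 1)) :
    g ∈ G n 1 ∨ g * tau n 1 ∈ G n 1 := by
  rcases (show n = 1 ∨ 2 ≤ n by omega) with rfl | hn2
  · exact Or.inl (mem_G_of_n_eq_one g)
  -- the induced maps `T`, `S = T⁻¹` of `Mat_n` (`Mat_n ≅ Mat_n^1`)
  let ofM : Matrix (Fin n) (Fin n) ℂ →ₗ[ℂ] Tuple n 1 := LinearMap.pi fun _ => LinearMap.id
  let toM : Tuple n 1 →ₗ[ℂ] Matrix (Fin n) (Fin n) ℂ := LinearMap.proj 0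
  let T : Matrix (Fin n) (Fin n) ℂ →ₗ[ℂ] Matrix (Fin n) (Fin n) ℂ :=
    toM ∘ₗ (g : Tuple n 1 →ₗ[ℂ] Tuple n 1) ∘ₗ ofM
  let S : Matrix (Fin n) (Fin n) ℂ →ₗ[ℂ] Matrix (Fin n) (Fin n) ℂ :=
    toM ∘ₗ ((g⁻¹ : LinearMap.GeneralLinearGroup ℂ (Tuple n 1)) : Tuple n 1 →ₗ[ℂ] Tuple n 1) ∘ₗ ofM
  have hT : ∀ X, T X = (g : Tuple n 1 →ₗ[ℂ] Tuple n 1) (fun _ => X) 0 := fun X => rfl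
  have hS : ∀ X, S X =
      ((g⁻¹ : LinearMap.GeneralLinearGroup ℂ (Tuple n 1)) : Tuple n 1 →ₗ[ℂ] Tuple n 1) (fun _ => X) 0 :=
    fun X => rfl
  have hST : ∀ X, S (T X) = X := by
    intro X
    rw [hS, hT, const_apply_zero_eq, inv_apply_apply]
  have hTS : ∀ X, T (S X) = X := by
    intro X
    rw [hT, hS, const_apply_zero_eq, apply_inv_apply]
  have hginv : g⁻¹ ∈ symmetryGroup (SING n 1) := (symmetryGroup (SING n 1)).inv_mem hg
  have hdetT : ∀ Z, (T Z).det = 0 ↔ Z.det = 0 := fun Z => by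
    rw [hT, det_apply_eq_zero_iff hg]
  have hdetS : ∀ Z, (S Z).det = 0 ↔ Z.det = 0 := fun Z => by
    rw [hS, det_apply_eq_zero_iff hginv]
  have hTr : ∀ u w : Fin n → ℂ, ∃ u' w', T (vecMulVec u w) = vecMulVec u' w' :=
    map_vecMulVec_of_det_iff hTS hdetT
  have hSr : ∀ u w : Fin n → ℂ, ∃ u' w', S (vecMulVec u w) = vecMulVec u' w' :=
    map_vecMulVec_of_det_iff hST hdetS
  have h01 : (⟨0, by omega⟩ : Fin n) ≠ ⟨1, by omega⟩ := by simp [Fin.ext_iff]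
  obtain ⟨U, V, hUV⟩ := MarcusMoyls.exists_sandwich_or_transpose_sandwich hST hTS hTr hSr h01
  -- `U`, `V` are invertible since `T` is onto: `T (S 1) = 1`
  have hinv : ∀ W : Matrix (Fin n) (Fin n) ℂ, U * W * V = 1 → U.det ≠ 0 ∧ V.det ≠ 0 := by
    intro W hW
    have hdet1 := congrArg Matrix.det hW
    rw [Matrix.det_mul, Matrix.det_mul, Matrix.det_one] at hdet1
    refine ⟨fun h0 => ?_, fun h0 => ?_⟩
    · rw [h0, zero_mul, zero_mul] at hdet1
      exact zero_ne_one hdet1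
    · rw [h0, mul_zero] at hdet1
      exact zero_ne_one hdet1
  have hgZ : ∀ Z : Tuple n 1, (g : Tuple n 1 →ₗ[ℂ] Tuple n 1) Z 0 = T (Z 0) := by
    intro Z
    rw [hT, const_apply_zero_eq]
  rcases hUV with h | h
  · obtain ⟨hU, hV⟩ := hinv (S 1) (by rw [← h, hTS])
    left
    exact mem_G_one_of_sandwich hU hV fun Z => by rw [hgZ, h]
  · obtain ⟨hU, hV⟩ := hinv (S 1)ᵀ (by rw [← h, hTS])
    right
    refine mem_G_one_of_sandwich hU hV fun Z => ?_
    rw [Units.val_mul, Module.End.mul_apply, hgZ, h, tau_apply, Matrix.transpose_transpose]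

end MakamWigderson

/-! ### The discharge -/

open MakamWigderson in
/-- **MW 2021, Thm. 1.12 (Frobenius) — `makamWigderson2021_thm_1_12` holds**: for `n ≥ 1`,
`𝒢_{SING_{n,1}} = G_{n,1} ∪ G_{n,1}·τ` (symmetries of the determinant hypersurface are
`X ↦ PXQ` and `X ↦ PXᵀQ`, `P, Q ∈ GL_n`). [cite: MakamWigderson2021, Thm. 1.12] -/
theorem makamWigderson2021_thm_1_12_holds : makamWigderson2021_thm_1_12 := fun _ hn _ =>
  ⟨mem_G_or_of_mem_symmetryGroup_SING_one hn, mem_symmetryGroup_SING_of_mem_G_or⟩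

end Literature.Computability.AlgebraicComplexity

end
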